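import Summits.BirchSwinnertonDyer.BirchSwinnertonDyer.Theorems.SignedLowerHalvesSmallImageLowerHalfBothSignsLambdaLowerThreeNsTamagawa
import Summits.BirchSwinnertonDyer.BirchSwinnertonDyer.Theorems.SignedLowerHalvesKobayashiLowerHalfLargeImageLambdaTwoStratumRankZero
import Summits.BirchSwinnertonDyer.Rank1Residual.Supersingular.MazurTateCertificates
import Literature.NumberTheory.EllipticCurves.Kim2008.AlgebraicFunctionalEquationSigned
import Literature.NumberTheory.EllipticCurves.Kobayashi2003.SignedColemanKatoZetaJoint
import Literature.NumberTheory.EllipticCurves.Rank1Residual.Typed.X7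
import HarnessLib

/-!
# Route `SignedLowerHalves`, crux L `SmallImageLowerHalfBothSigns` (item stmt-BirchSwinnertonDyer-23599):
# the SPLIT CLOSER AT `p ≥ 5` — crux L's body at a rank-`0` small-image pair WITH A SPLIT MULTIPLICATIVE PRIME from print +
# TWO displayed Mazur–Tate rows `(μ, λ)(L^±_p) = (0, 2)` — NO partner, NO transport, NO floor binder

Width seat `bsd-line-slh-p3-w3` g14 under LEAD `cruxlead-stmt-BirchSwinnertonDyer-23599` g3 (cell `bsd-ssimc`); ROUTE-INDEPENDENT
helper (`--supports stmt-BirchSwinnertonDyer-23599`); THEOREMS ONLY — no definition, no named fact, no `sorry`; PER PAIR machinery;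
closes nothing class-wide; BSD / crux L are NOT proved by this.

WHAT. Width seat g5 of this lineage landed, for the archived stub `stub_lambdaLowerThree_ns`, the GENERAL-`p` small-image «λ = 2
closer» `SmallImageLambdaLowerThreeNsTamagawa.forall_kobayashiLowerDivisibility_of_certs_of_finite_of_afe_of_not_surj_of_split`
(file `…LambdaLowerThreeNsTamagawa`): at a pair (`p` odd, good, `a_p = 0`, `ρ̄` NOT onto) with a SPLIT multiplicative prime `ℓ`
(there `p ∣ c_ℓ = ord_ℓ Δ_min` automatically, Serre Prop. 15 + Tate), the certificates `(μ, λ)(L^ε_p) = (0, 2)` at both signs,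
`Sel_{p^∞}(E/ℚ)` finite and the algebraic functional equation of `char X^ε` give `∀ ε, KobayashiLowerDivisibility W p ε` (indeed the
main conjecture at both signs) modulo `h12 h41 hCK hK13 h5 h3`. It was instantiated at NO pair: at `p = 3` the AFE is not in print and
the tier-T2 rows were never tabulated. AT `p ≥ 5` EVERY INPUT IS NOW IN THE TREE OR ON THE ITEM: the AFE is B. D. Kim 2008 Thm 3.12
(named fact `Kim2008.thm312_signedSelmerDual_charIdeal_map_invol`, `3 < p`, both signs); finiteness of `Sel_{p^∞}` at analytic rank `0`
is GZK (`LargeImageLambdaTwoStratum.finite_selmerGroupPInfty_of_analyticRank_eq_zero`); the certificates are ONE EVEN and ONE ODD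
Mazur–Tate row (b2b `lam_signed_one/neg_one_eq_of_mazurTate'`, image-free) — and the crux's standing disprover tabulated such rows with
TWO agreeing engines for all 36 small-image pairs at `p ≥ 5` (kit j335262, `gvkan2/LAYERS.tsv`, evidence #53–#56). This file packages
the closer in that currency: ★ `forall_kobayashiLowerDivisibility_of_split_of_mazurTateRows` — print inputs `hJ h12 h41 hK13 hK08 h5 h3
hmod hGZK` BY NAME, displayed `r_an = 0`, two rows, a split multiplicative prime (kernel certificate per pair: a root of the node-tangent
quadratic), and `¬ Surj W p` (crux L's own premise; the mechanism uses it twice: `p ∣ c_ℓ` and `μ`-control). Records: sibling files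
`…RttSplitCloserRecords01–02` — 9 of the 10 tier-T2 pairs of the LEAD's board at `p ≥ 5` (the tenth, `431433o1 @ 5`, has `λ = 4, 6`).

References: [Kobayashi2003] Conjecture (p. 2), Thm. 1.2, 4.1, 6.2–7.3; [KimBD2008MRL] Thm. 3.12 (p. 93); [BDKim2013] Cor. 3.15;
[Pollack2003] Prop. 6.9, 6.10, 6.18; [Serre1972] §2.4 Prop. 15; [SilvermanATAEC1994] Cor. IV.9.2(d); [Darmon2004] Thm. 3.22;
[GreenbergVatsal2000] §3 Rem. 3.4; [BreuilConradDiamondTaylor2001] Thm. A.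
-/

set_option autoImplicit false
-- D-0017: single-problem summit, the namespace repeats the problem name by design.
set_option linter.dupNamespace false
noncomputable section

open scoped Classical MatrixGroups ModularForm

open CongruenceSubgroup WeierstrassCurve Field Polynomial
  Literature.NumberTheory.EllipticCurves Literature.NumberTheory.EllipticCurves.ModularForms
  Literature.NumberTheory.EllipticCurves.Rank1Residual
  Literature.NumberTheory.EllipticCurves.Kobayashi2003 ZpExtension
  Literature.NumberTheory.EllipticCurves.GreenbergVatsal2000
  Summit.BirchSwinnertonDyer.Rank1Residual.Supersingular
  Summit.BirchSwinnertonDyer.Rank1Residual.X1.MuLambda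

namespace Summit.BirchSwinnertonDyer.BirchSwinnertonDyer.Theorems.SmallImageRttOneSided

section SplitCloser

variable (W : WeierstrassCurve ℚ) [W.IsElliptic] [W.IsGloballyMinimal] (p : ℕ) [Fact p.Prime]

/-- ★ **THE SPLIT CLOSER AT `p ≥ 5` IN ROW CURRENCY: crux L's body `∀ ε, KobayashiLowerDivisibility W p ε` at a rank-`0` small-image
pair with a split multiplicative prime, from print + two Mazur–Tate rows — NO partner.** `W/ℚ` globally minimal, `3 < p` good with
`a_p = 0`, `ρ̄_{W,p}` NOT onto (`hs`), analytic rank `0` (`hr`, displayed); an EVEN row (`θ_{n_e}(f) = Θ ∈ Λ`, `Θ ≠ 0`, `μ(Θ) = 0`,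
`λ(Θ) = deg ω_{n_e}^− + 2`) and an ODD row (`… = deg ω_{n_o}^+ + 2`) for every newform `f` of `W` (displayed: `(μ, λ)(L^±_p) = (0, 2)`); a
split multiplicative prime `ℓ` (kernel certificate per pair). GRANTED BY NAME: Kobayashi's Coleman–Kato package / Thm 1.2 / Thm 4.1
rational (`hJ h12 h41`), B. D. Kim 2013 Cor 3.15 (`hK13`), B. D. Kim 2008 Thm 3.12 (`hK08`, the AFE, `p > 3`), the period units (`h5 h3`),
modularity (`hmod`, a newform of `W`), Gross–Zagier–Kolyvagin (`hGZK`, `Sel_{p^∞}` finite at `r_an = 0`). Mechanism = w3 g5's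
`forall_kobayashiLowerDivisibility_of_certs_of_finite_of_afe_of_not_surj_of_split` (λ-two stratum: `p ∣ c_ℓ` is automatic at small
image, Kim 2013 makes `ξ^ε(0)` a non-unit, the AFE makes `λ(ξ^ε)` even, so `λ(ξ^ε) ≥ 2 = λ(L^ε)` and Kato's rational divisibility
closes the squeeze). Per pair; CONDITIONAL on print and the displayed data; closes nothing class-wide.
[cite: Kobayashi2003, Conjecture (p. 2), Thm. 1.2, Thm. 4.1 (p. 8)] [cite: KimBD2008MRL, Thm. 3.12 (p. 93)] [cite: BDKim2013, Cor. 3.15 (p. 199)]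
[cite: Pollack2003, Prop. 6.9, Prop. 6.10 and Prop. 6.18] [cite: Serre1972, §2.4 Prop. 15] [cite: Darmon2004, Thm. 3.22] -/
theorem forall_kobayashiLowerDivisibility_of_split_of_mazurTateRows
    (hJ : thm62_63_73_signedColemanKato_zetaJoint) (h12 : thm12_signedSelmerDual_finite_torsion)
    (h41 : thm41_signedCharIdeal_divisibility) (hK13 : BDKim2013.cor315_signedCharValue_rankZero)
    (hK08 : Kim2008.thm312_signedSelmerDual_charIdeal_map_invol)
    (h5 : realPeriodRat_eq_unit_mul_plusPeriod) (h3 : realPeriodRat_eq_unit_mul_plusPeriod_three)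
    (hmod : exists_isNewformOf) (hGZK : rank_eq_analyticRank_of_analyticRank_le_one)
    (hp : 3 < p) (hgood : W.HasGoodReductionAtPrime p) (hap : W.frobeniusTrace p = 0) (hs : ¬ Surj W p)
    (hr : W.analyticRank = 0)
    {ne : ℕ} (hne : Even ne)
    (hrowE : ∀ [NeZero (W.conductorNorm ℤ)] (f : CuspForm (Gamma0 (W.conductorNorm ℤ)) 2), IsNewformOf W f →
      ∃ Θ : IwasawaAlgebra p, iwasawaToPowerSeries p Θ =
          ((mazurTateElement f p ne).map (algebraMap ℚ ℚ_[p]) : PowerSeries ℚ_[p]) ∧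
        Θ ≠ 0 ∧ mu Θ = 0 ∧ lam Θ = (cyclotomicOmegaMinus p ne).natDegree + 2)
    {no : ℕ} (hno : Odd no)
    (hrowO : ∀ [NeZero (W.conductorNorm ℤ)] (f : CuspForm (Gamma0 (W.conductorNorm ℤ)) 2), IsNewformOf W f →
      ∃ Θ : IwasawaAlgebra p, iwasawaToPowerSeries p Θ =
          ((mazurTateElement f p no).map (algebraMap ℚ ℚ_[p]) : PowerSeries ℚ_[p]) ∧
        Θ ≠ 0 ∧ mu Θ = 0 ∧ lam Θ = (cyclotomicOmegaPlus p no).natDegree + 2)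
    {ℓ : ℕ} [Fact ℓ.Prime] (hsplit : W.HasSplitMultiplicativeReductionAtPrime ℓ) :
    ∀ ε : ℤˣ, KobayashiLowerDivisibility W p ε := by
  haveI hN : NeZero (W.conductorNorm ℤ) := ⟨(W.conductorNorm_pos_holds).ne'⟩
  obtain ⟨f₀, hf₀⟩ := hmod W
  have hp2 : p ≠ 2 := by omega
  have hAFE : ∀ (ε : ℤˣ) (κ : ZpExtension ℚ p) (γ : absoluteGaloisGroup ℚ), κ.IsCyclotomic → κ.IsTopGenerator γ →
      ∀ D : SignedSelmerDualData W κ γ ε, Ideal.map (IwasawaAlgebra.invol p) D.charIdeal = D.charIdeal :=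
    fun ε κ γ hκ hγ D ↦ hK08 W p hp hgood hap κ γ hκ hγ ε D
  have hcert : ∀ (ε : ℤˣ) (L : IwasawaAlgebra p), IsSignedPAdicLFunction f₀ p ε L → mu L = 0 ∧ lam L = 2 := by
    intro ε L hL
    rcases Int.units_eq_one_or ε with h1 | h1
    · subst h1
      obtain ⟨Θ, hΘ, hΘ0, hμ, hlam⟩ := hrowE f₀ hf₀
      exact lam_signed_one_eq_of_mazurTate' hp2 hf₀ hgood hap hL hne hΘ hΘ0 hμ hlam
    · subst h1
      obtain ⟨Θ, hΘ, hΘ0, hμ, hlam⟩ := hrowO f₀ hf₀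
      exact lam_signed_neg_one_eq_of_mazurTate' hp2 hf₀ hgood hap hL hno hΘ hΘ0 hμ hlam
  have hfin : Finite (W.selmerGroupPInfty p) :=
    LargeImageLambdaTwoStratum.finite_selmerGroupPInfty_of_analyticRank_eq_zero W p hGZK hr
  exact SmallImageLambdaLowerThreeNsTamagawa.forall_kobayashiLowerDivisibility_of_certs_of_finite_of_afe_of_not_surj_of_split
    W p h12 h41 (thm62_63_73_signedColemanKato_zeta_of_joint hJ) hK13 h5 h3 hp2 hgood hap hs hAFE hf₀ hcert hfin hsplit

/-- **The same with the class tag**: at a pair that is moreover X7 (`ClassX7 W p`: good supersingular at `p` and NOT semistable) the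
conclusion is recorded as `ClassX7 W p ∧ ∀ ε, KobayashiLowerDivisibility W p ε` (crux L's body on its own domain). Trivial repackaging
for the records. [cite: Kobayashi2003, Conjecture (p. 2)] [cite: KimBD2008MRL, Thm. 3.12 (p. 93)] -/
theorem classX7_and_forall_kobayashiLowerDivisibility_of_split_of_mazurTateRows
    (hJ : thm62_63_73_signedColemanKato_zetaJoint) (h12 : thm12_signedSelmerDual_finite_torsion)
    (h41 : thm41_signedCharIdeal_divisibility) (hK13 : BDKim2013.cor315_signedCharValue_rankZero)
    (hK08 : Kim2008.thm312_signedSelmerDual_charIdeal_map_invol)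
    (h5 : realPeriodRat_eq_unit_mul_plusPeriod) (h3 : realPeriodRat_eq_unit_mul_plusPeriod_three)
    (hmod : exists_isNewformOf) (hGZK : rank_eq_analyticRank_of_analyticRank_le_one)
    (hp : 3 < p) (hX : ClassX7 W p) (hap : W.frobeniusTrace p = 0) (hs : ¬ Surj W p)
    (hr : W.analyticRank = 0)
    {ne : ℕ} (hne : Even ne)
    (hrowE : ∀ [NeZero (W.conductorNorm ℤ)] (f : CuspForm (Gamma0 (W.conductorNorm ℤ)) 2), IsNewformOf W f →
      ∃ Θ : IwasawaAlgebra p, iwasawaToPowerSeries p Θ =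
          ((mazurTateElement f p ne).map (algebraMap ℚ ℚ_[p]) : PowerSeries ℚ_[p]) ∧
        Θ ≠ 0 ∧ mu Θ = 0 ∧ lam Θ = (cyclotomicOmegaMinus p ne).natDegree + 2)
    {no : ℕ} (hno : Odd no)
    (hrowO : ∀ [NeZero (W.conductorNorm ℤ)] (f : CuspForm (Gamma0 (W.conductorNorm ℤ)) 2), IsNewformOf W f →
      ∃ Θ : IwasawaAlgebra p, iwasawaToPowerSeries p Θ =
          ((mazurTateElement f p no).map (algebraMap ℚ ℚ_[p]) : PowerSeries ℚ_[p]) ∧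
        Θ ≠ 0 ∧ mu Θ = 0 ∧ lam Θ = (cyclotomicOmegaPlus p no).natDegree + 2)
    {ℓ : ℕ} [Fact ℓ.Prime] (hsplit : W.HasSplitMultiplicativeReductionAtPrime ℓ) :
    ClassX7 W p ∧ ∀ ε : ℤˣ, KobayashiLowerDivisibility W p ε :=
  ⟨hX, forall_kobayashiLowerDivisibility_of_split_of_mazurTateRows W p hJ h12 h41 hK13 hK08 h5 h3 hmod hGZK hp hX.1.1 hap hs hr
    hne hrowE hno hrowO hsplit⟩

end SplitCloser

end Summit.BirchSwinnertonDyer.BirchSwinnertonDyer.Theorems.SmallImageRttOneSided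

end
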